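import Summits.Langlands.Langlands.Theses.ParityBlindBianchi

/-!
BC3 birth skeleton — child `ReciprocityDataNonempty` of `ParityBlindBianchi.EvenArtinJunction` (stmt-Langlands-2908),
crux-strategist planner-cstrat-stmt-Langlands-2908-r1-0, 2026-08-17.  Exactly 2 named stubs (the ONLY sorries) and
`ReciprocityDataNonempty_of : stub₁ → stub₂ → ReciprocityDataNonempty` kernel-checked.  Context = the route file's (the child is restated from Sketch.lean;
after `route edit --split` installs the child decl, delete the `def` below and re-run `ledger skeleton check`).
Stubs: N₁ existence of a local Langlands datum at every completion (Harris–Taylor/Henniart); N₂ transport to the canonical Artin/ε normalisation.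
-/

set_option linter.dupNamespace false

namespace Summit.Langlands.Langlands.Theses.ParityBlindBianchi

open scoped BigOperators Topology Manifold Classical MeasureTheory ProbabilityTheory Matrix InnerProductSpace ComplexConjugate ContinuousMap
open Filter Set Function TopologicalSpace MeasureTheory

/-- N — reciprocity data exist over every number field. -/
def ReciprocityDataNonempty : Prop :=
  ∀ (K : Type) [Field K] [NumberField K], Nonempty (ReciprocityData K)

namespace Cruxes.ReciprocityDataNonempty.Birth

/-- **stub N₁ (IN PRINT, formalisation debt: the local Langlands correspondence for `GL_n(K_v)` exists)** — a
`LocalLanglandsDatum` at every completion of every number field: Harris–Taylor 2001 Thm. A / Henniart 2000 Thm. 1.2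
with local class field theory and Deligne's local constants; the tree's named fact `LocalLanglandsDatum.nonempty`
instantiated at `K_v`. [cite: HarrisTaylorAMS2001, Thm. A] [cite: HenniartInventiones2000, Thm. 1.2] -/
theorem stub_llcAtCompletions :
    ∀ (K : Type) [Field K] [NumberField K] (v : IsDedekindDomain.HeightOneSpectrum (NumberField.RingOfIntegers K)), Nonempty (Literature.NumberTheory.Automorphic.LocalLanglandsDatum (v.adicCompletion K)) := by
  sorry

/-- **stub N₂ (IN PRINT, Lean-heavy: transport of a local Langlands datum to THE canonical normalisation)** —
given any datum at `K_v`, one whose local Artin map is `canonicalArtin (K_v)` and whose `ε`-system is normalised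
against the canonical Artin maps of all finite extensions `E/K_v` (the two pins of `ReciprocityData`, D-0032 §4c):
twist `rec_n` and the `ε`-system along the automorphism relating the two Artin normalisations; uniqueness of the
local Artin map (Lubin–Tate, named fact `IsLocalArtinMap.unique`) and of Deligne's constants.
[cite: SerreLocalFields1979, Ch. XIII §4 Thm. 1–2] [cite: HarrisTaylorAMS2001, Thm. A] -/
theorem stub_renormalise :
    ∀ (K : Type) [Field K] [NumberField K] (v : IsDedekindDomain.HeightOneSpectrum (NumberField.RingOfIntegers K)), Literature.NumberTheory.Automorphic.LocalLanglandsDatum (v.adicCompletion K) → ∃ L' : Literature.NumberTheory.Automorphic.LocalLanglandsDatum (v.adicCompletion K), L'.artin.IsCanonical ∧ ∀ (E : Type) [Field E] [ValuativeRel E] [TopologicalSpace E] [IsNonarchimedeanLocalField E] [Algebra (v.adicCompletion K) E] [FiniteDimensional (v.adicCompletion K) E], (L'.eps.artin E).IsCanonical := by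
  sorry

/-- **N from its two stubs**: choose, at every finite place, a canonically normalised datum. -/
theorem ReciprocityDataNonempty_of :
    (∀ (K : Type) [Field K] [NumberField K] (v : IsDedekindDomain.HeightOneSpectrum (NumberField.RingOfIntegers K)), Nonempty (Literature.NumberTheory.Automorphic.LocalLanglandsDatum (v.adicCompletion K))) →
    (∀ (K : Type) [Field K] [NumberField K] (v : IsDedekindDomain.HeightOneSpectrum (NumberField.RingOfIntegers K)), Literature.NumberTheory.Automorphic.LocalLanglandsDatum (v.adicCompletion K) → ∃ L' : Literature.NumberTheory.Automorphic.LocalLanglandsDatum (v.adicCompletion K), L'.artin.IsCanonical ∧ ∀ (E : Type) [Field E] [ValuativeRel E] [TopologicalSpace E] [IsNonarchimedeanLocalField E] [Algebra (v.adicCompletion K) E] [FiniteDimensional (v.adicCompletion K) E], (L'.eps.artin E).IsCanonical) →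
    ReciprocityDataNonempty := by
  intro h1 h2 K _ _
  have h : ∀ v : IsDedekindDomain.HeightOneSpectrum (NumberField.RingOfIntegers K),
      ∃ L' : Literature.NumberTheory.Automorphic.LocalLanglandsDatum (v.adicCompletion K), L'.artin.IsCanonical ∧
        ∀ (E : Type) [Field E] [ValuativeRel E] [TopologicalSpace E] [IsNonarchimedeanLocalField E]
          [Algebra (v.adicCompletion K) E] [FiniteDimensional (v.adicCompletion K) E], (L'.eps.artin E).IsCanonical :=
    fun v => h2 K v (Classical.choice (h1 K v))
  choose L hL₁ hL₂ using h
  exact ⟨⟨L, hL₁, fun v E _ _ _ _ _ _ => hL₂ v E⟩⟩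

/-- The composition with the stubs plugged in: `ReciprocityDataNonempty` modulo exactly {N₁, N₂}. -/
theorem ReciprocityDataNonempty_of_stubs : ReciprocityDataNonempty :=
  ReciprocityDataNonempty_of stub_llcAtCompletions stub_renormalise

end Cruxes.ReciprocityDataNonempty.Birth

end Summit.Langlands.Langlands.Theses.ParityBlindBianchi
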